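import Summits.Ventures.PercRepro.C026PFunBlockReduction

/-!
# CONJECTURE (P) with two live vertices reduces to skeletons without a cut vertex (p6, gen 21)

The band-state form of the block reduction (`C026PFunBlockReduction`): if the corner identity `(E00)`
holds on every skeleton without a cut vertex, then `(P) ≥ 0` at every band state of the probe and the
two live vertices on every skeleton (`pFun_threeCells_nonneg_of_forall_noCutVertex`, via
`pFun_threeCells_nonneg_of_E00`).  With `C026PFunBareDegreeTwo`, the cycle and theta skeletons are
among the cut-vertex-free skeletons already settled.
-/

namespace PercRepro

namespace MultiGraph

open Finset

universe w

variable {V : Type*} [Fintype V] [DecidableEq V]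

open Classical in
/-- **THEOREM L2 on every skeleton from `(E00)` on the skeletons without a cut vertex**: `(P) ≥ 0` at
every band state of the probe `c` and the live vertices `a, b`. -/
theorem pFun_threeCells_nonneg_of_forall_noCutVertex
    (H : ∀ (E' : Type w) [Fintype E'] (G' : MultiGraph V E'), ¬ G'.HasCutVertex →
      ∀ a b c : V, 0 ≤ G'.pFun c (liveCells a b) (liveCells a b) univ)
    {E₀ : Type w} [Fintype E₀] (G : MultiGraph V E₀) (a b c : V)
    {z κ x₁ K₁ x₂ K₂ : ℝ} (hz : 0 ≤ z ∧ z ≤ 1) (hκ : kMin z ≤ κ) (hx₁ : 0 ≤ x₁ ∧ x₁ ≤ 1)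
    (hx₂ : 0 ≤ x₂ ∧ x₂ ≤ 1) (hK₁ : kMin x₁ ≤ K₁) (hK₂ : kMin x₂ ≤ K₂) :
    0 ≤ G.pFun c (threeCells c a b z x₁ x₂) (threeCells c a b κ K₁ K₂) univ :=
  pFun_threeCells_nonneg_of_E00 c a b hz hκ hx₁ hx₂ hK₁ hK₂
    (pFun_liveCells_nonneg_of_forall_noCutVertex H G a b c)

end MultiGraph

end PercRepro
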